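import Summits.AtomisticToContinuum.Crystallization.Theorems.ChargedEnergyGapHcpAffineStabilityBox
import Summits.AtomisticToContinuum.Crystallization.Theorems.ChargedEnergyGapStackingClass
import HarnessLib

/-!
# Charged energy gap — lens-3 g69, «HcpAffineStabilitySym»: REPAIR of the hcp affine stability certificate (critic row 1292, (R-i) + (R-ii))

Cell `decomp-a2c`, seat lens-3, generation 69 (APPEND over the tree's «HcpAffineStabilityBox» `…Theorems.ChargedEnergyGapHcpAffineStabilityBox`
(p852646) and «StackingClass» `…Theorems.ChargedEnergyGapStackingClass` (p852546, for `IsSiteStressFree.siteVirial_eq_zero`); same namespace).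
ELEMENTARY · PROVED; complete (no placeholders); standard axioms.  Line `stmt-AtomisticToContinuum-14231` (`PricedLinkCensus.ChargedEnergyGap`),
certificate leaf [A-i]ʰ of the (R4) record.

THE DEFECT REPAIRED (census ⑥″ (3), STATUS 2026-09-02 l.6356; critic row 1292, CONFIRMED).  `Hcp.HcpAffineStabilityBox a₁ a₂ h₁ h₂ κ` quantifies over ALL
linear probes `A`; on the rotation generator `W x = ω × x` its left side is `κ·⟪u, W u⟫² = 0` while its right side is the SITE VIRIAL combination
`¼·ωᵀ(tr T·I − T)ω`, which changes sign through the stress-free point — so the box statement is FALSE for every `κ` on every box with the hcp point in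
its interior, and the landed glue `Hcp.sitewiseAffineStability_hcpClass_of_box` is vacuous as a reduction.

THE REPAIR.
* §N7 (R-i) ★ ENGINE `tsum_virial_quadForm_eq_zero`: at a site whose site virial vanishes identically, `Σ'_z (V′(d)/d)·⟪x, B x⟫ = 0` for EVERY linear
  `B` (`x = z − y`; `inner_apply_eq_sum` + `summable_virial` — all pairs `T_y(a, b)` in hand, no symmetry argument).  With the probe's symmetric part
  `probeSym A = ½(A + Aᵀ)` (`LinearMap.adjoint`): bondwise `bondQuad(A) − bondQuad(probeSym A) = (V′(d)/d)·⟪x, D_A x⟫` for the linear map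
  `D_A = AᵀA − SᵀS` (`bondQuad_affineField_sub_probeSym`; the longitudinal components agree, `inner_probeSym_self`), hence ★ `quadSite_affineField_eq_probeSym`:
  `quadSite (affineField A) P ∅ y = quadSite (affineField (probeSym A)) P ∅ y` at every site with zero site virial, and ★ `sitewiseAffineStability_of_symm`:
  the sitewise affine stability inequality over SYMMETRIC probes implies it over ALL probes there (`⟪u, A u⟫ = ⟪u, (probeSym A) u⟫`).
* (R-ii) ★ `Hcp.HcpAffineStabilityBoxSym a₁ a₂ h₁ h₂ κ` · UNDECIDED · TRUE-leaning · CERT-able: the certificate RESTATED OVER SYMMETRIC PROBES ONLY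
  (`A.IsSymmetric`, i.e. `∀ v w, ⟪A v, w⟫ = ⟪v, A w⟫`; normalisation `‖u‖ = 1`; the `¼` included; `ε = ±1`; base sites `m = 0, 1`) — no stress-free
  hypotheses inside the certificate (census floats kappa_sym.py: `κ_sym = 3.63–3.80` at the four corners of the designate box
  `[9702, 9723] × [7919, 7940]·10⁻⁴`, `3.72` at the root, against the target `κ = 3/8`: margin `× 9.7`).  The vacuous certificate implies it
  (`hcpAffineStabilityBoxSym_of_box`), so nothing proved from the old one is lost; it is antitone in `κ`.
* ★★ `Hcp.sitewiseAffineStability_hcpClass_of_boxSym`: `HcpScaleBox a₁ a₂ h₁ h₂ → HcpAffineStabilityBoxSym a₁ a₂ h₁ h₂ κ →` for EVERY site-stress-free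
  periodic presentation of an isometric image of an hcp-class stacking and EVERY `y ∈ P.points`: `∀ A u, ‖u‖ = 1 → κ⟪u, A u⟫² ≤ quadSite (affineField A) P ∅ y`
  — the SAME conclusion as the vacuous glue, now from a satisfiable certificate.  Proof: the symmetric-probe inequality at the base sites of
  `P₀ = barlowPeriodicConfiguration (ε·alternatingHagg)` from the certificate (`quadSite_affineField_barlow_eq_tsum`), transported along the period and
  the rigid motion by the SYMMETRIC-CLASS transport `sitewiseAffineStabilitySym_transport` (conjugation by a linear isometry preserves symmetry,
  `conjA_isSymmetric`), then upgraded to all probes at `y` by (R-i) (`IsSiteStressFree.siteVirial_eq_zero`).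
ROTATION-INSTANCE DISCIPLINE (row 1292 LESSON): antisymmetric probes are excluded from (R-ii) by hypothesis (the only antisymmetric symmetric map is `0`,
`isSymmetric_skew_eq_zero`), and on the consumer side they are discharged EXACTLY by (R-i) — the virial combination is `0` by `IsSiteStressFree`, not bounded.
RECORD 14231: «[A-i]ʰ ⟸ HcpScaleBox ∧ HcpAffineStabilityBoxSym» replaces the struck «… ∧ HcpAffineStabilityBox».
-/

noncomputable section
open scoped Classical
open Literature.MathematicalPhysics.StatisticalMechanics Literature.Geometry.DiscreteGeometry
open Summit.AtomisticToContinuum.Crystallization.Theses.PricedLinkCensus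
open Summit.AtomisticToContinuum.Crystallization.Theorems.ChargedEnergyGapNegative

namespace Summit.AtomisticToContinuum.Crystallization.Theorems.ChargedEnergyGapChartDial

/-! ## §N7 (R-i): virial-weighted quadratic forms vanish at a site with zero site virial; the symmetric part of a probe -/

section VirialForms

variable {P : PeriodicConfiguration 3} {y : E3}

/-- ★ ENGINE (R-i): at a site whose site virial vanishes identically, the `V′(d)/d`-weighted site sum of EVERY quadratic form `x ↦ ⟪x, B x⟫` of the
bond vector vanishes (expand in the standard basis: a finite combination of the site virials `T_y(eᵢ, B eᵢ)`). -/
theorem tsum_virial_quadForm_eq_zero (hV : ∀ a b : E3, siteVirial P y a b = 0) (B : E3 →ₗ[ℝ] E3) :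
    ∑' z : {z : E3 // z ∈ P.points ∧ z ≠ y}, ljD1 (dist y z) / dist y (z : E3) * inner ℝ ((z : E3) - y) (B ((z : E3) - y)) = 0 := by
  set b := EuclideanSpace.basisFun (Fin 3) ℝ
  have h : ∀ z : {z : E3 // z ∈ P.points ∧ z ≠ y}, ljD1 (dist y z) / dist y (z : E3) * inner ℝ ((z : E3) - y) (B ((z : E3) - y)) =
      ∑ i, ljD1 (dist y z) / dist y (z : E3) * (inner ℝ ((z : E3) - y) (b i) * inner ℝ ((z : E3) - y) (B (b i))) := fun z => by
    rw [inner_apply_eq_sum, Finset.mul_sum]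
  rw [tsum_congr h, Summable.tsum_finsetSum (fun i _ => summable_virial P y (b i) (B (b i)))]
  exact Finset.sum_eq_zero fun i _ => hV (b i) (B (b i))

/-- The SYMMETRIC PART `½(A + Aᵀ)` of a probe (`Aᵀ = LinearMap.adjoint A`). -/
def probeSym (A : E3 →ₗ[ℝ] E3) : E3 →ₗ[ℝ] E3 :=
  (1 / 2 : ℝ) • (A + LinearMap.adjoint A)

/-- Pointwise form. [formal bookkeeping] -/
theorem probeSym_apply (A : E3 →ₗ[ℝ] E3) (x : E3) : probeSym A x = (1 / 2 : ℝ) • (A x + LinearMap.adjoint A x) := rfl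

/-- The symmetric part is symmetric. -/
theorem probeSym_isSymmetric (A : E3 →ₗ[ℝ] E3) : (probeSym A).IsSymmetric := by
  intro v w
  simp only [probeSym_apply, real_inner_smul_left, real_inner_smul_right, inner_add_left, inner_add_right,
    LinearMap.adjoint_inner_left, LinearMap.adjoint_inner_right]
  ring

/-- A symmetric probe is its own symmetric part. -/
theorem probeSym_eq_self_of_isSymmetric {A : E3 →ₗ[ℝ] E3} (hA : A.IsSymmetric) : probeSym A = A := by
  have h : LinearMap.adjoint A = A := (LinearMap.isSymmetric_iff_isSelfAdjoint A).1 hA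
  rw [probeSym, h, ← two_smul ℝ A, smul_smul]
  norm_num

/-- The symmetric part has the same diagonal values: `⟪x, ½(A + Aᵀ) x⟫ = ⟪x, A x⟫`. -/
theorem inner_probeSym_self (A : E3 →ₗ[ℝ] E3) (x : E3) : inner ℝ x (probeSym A x) = inner ℝ x (A x) := by
  simp only [probeSym_apply, real_inner_smul_right, inner_add_right, LinearMap.adjoint_inner_right]
  rw [real_inner_comm x (A x)]
  ring

/-- A probe that is both symmetric and antisymmetric is `0` — the rotation generators of the row-1292 refutation are NOT symmetric probes (unless trivial). -/
theorem isSymmetric_skew_eq_zero {A : E3 →ₗ[ℝ] E3} (hA : A.IsSymmetric) (hW : ∀ v w : E3, inner ℝ (A v) w = -inner ℝ v (A w)) : A = 0 := by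
  refine LinearMap.ext fun v => ?_
  have h1 : inner ℝ (A v) (A v) = 0 := by
    have := hA v (A v)
    have := hW v (A v)
    linarith
  rw [LinearMap.zero_apply]
  exact inner_self_eq_zero.1 h1

/-- The SYMMETRISATION DEFECT map `D_A = AᵀA − SᵀS`, `S = probeSym A`: `⟪x, D_A x⟫ = ‖A x‖² − ‖S x‖²`. -/
def probeSymDefect (A : E3 →ₗ[ℝ] E3) : E3 →ₗ[ℝ] E3 :=
  LinearMap.adjoint A ∘ₗ A - LinearMap.adjoint (probeSym A) ∘ₗ probeSym A

/-- `⟪x, D_A x⟫ = ‖A x‖² − ‖(probeSym A) x‖²`. [formal bookkeeping] -/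
theorem inner_probeSymDefect (A : E3 →ₗ[ℝ] E3) (x : E3) : inner ℝ x (probeSymDefect A x) = ‖A x‖ ^ 2 - ‖probeSym A x‖ ^ 2 := by
  simp only [probeSymDefect, LinearMap.sub_apply, LinearMap.comp_apply, inner_sub_right, LinearMap.adjoint_inner_right,
    real_inner_self_eq_norm_sq]

/-- ★ Bondwise (R-i): the affine-probe quadratic bond terms of `A` and of its symmetric part differ by the virial-type term `(V′(d)/d)·⟪x, D_A x⟫`,
`x = z − y` (the longitudinal components `⟪ê, A x⟫ = ⟪ê, S x⟫` agree since `ê ∥ x`). -/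
theorem bondQuad_affineField_sub_probeSym (A : E3 →ₗ[ℝ] E3) (y z : E3) :
    bondQuad (affineField A) y z - bondQuad (affineField (probeSym A)) y z =
      ljD1 (dist y z) / dist y z * inner ℝ (z - y) (probeSymDefect A (z - y)) := by
  have hin : inner ℝ ((dist y z)⁻¹ • (z - y)) (probeSym A (z - y)) = inner ℝ ((dist y z)⁻¹ • (z - y)) (A (z - y)) := by
    rw [real_inner_smul_left, real_inner_smul_left, inner_probeSym_self]
  simp only [bondQuad, affineField_apply, hin, inner_probeSymDefect]
  ring

/-- ★ (R-i) SITEWISE: at a site with vanishing site virial (every point of a site-stress-free reference, `IsSiteStressFree.siteVirial_eq_zero`) the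
UNEXCISED affine-probe quadratic site term depends on the probe only through its symmetric part. -/
theorem quadSite_affineField_eq_probeSym (hV : ∀ a b : E3, siteVirial P y a b = 0) (A : E3 →ₗ[ℝ] E3) :
    quadSite (affineField A) P ∅ y = quadSite (affineField (probeSym A)) P ∅ y := by
  have hA : ∀ x, ‖A x‖ ≤ ‖LinearMap.toContinuousLinearMap A‖ * ‖x‖ := fun x => (LinearMap.toContinuousLinearMap A).le_opNorm x
  have hS : ∀ x, ‖probeSym A x‖ ≤ ‖LinearMap.toContinuousLinearMap (probeSym A)‖ * ‖x‖ := fun x =>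
    (LinearMap.toContinuousLinearMap (probeSym A)).le_opNorm x
  have h1 := summable_bondQuad_affineField P A y hA
  have h2 := summable_bondQuad_affineField P (probeSym A) y hS
  have h3 : ∑' z : {z : E3 // z ∈ P.points ∧ z ≠ y}, bondQuad (affineField A) y (z : E3) -
      ∑' z : {z : E3 // z ∈ P.points ∧ z ≠ y}, bondQuad (affineField (probeSym A)) y (z : E3) = 0 := by
    rw [← h1.tsum_sub h2, tsum_congr fun z : {z : E3 // z ∈ P.points ∧ z ≠ y} => bondQuad_affineField_sub_probeSym A y (z : E3)]
    exact tsum_virial_quadForm_eq_zero hV (probeSymDefect A)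
  rw [quadSite_empty_eq, quadSite_empty_eq]
  congr 1
  linarith

/-- ★ (R-i) CONSUMER FORM: at a site with vanishing site virial, sitewise affine stability over SYMMETRIC probes gives it over ALL probes
(`⟪u, A u⟫ = ⟪u, S u⟫`, `quadSite(A) = quadSite(S)`). -/
theorem sitewiseAffineStability_of_symm (hV : ∀ a b : E3, siteVirial P y a b = 0) {κ : ℝ}
    (h : ∀ A : E3 →ₗ[ℝ] E3, A.IsSymmetric → ∀ u : E3, ‖u‖ = 1 → κ * inner ℝ u (A u) ^ 2 ≤ quadSite (affineField A) P ∅ y) :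
    ∀ (A : E3 →ₗ[ℝ] E3) (u : E3), ‖u‖ = 1 → κ * inner ℝ u (A u) ^ 2 ≤ quadSite (affineField A) P ∅ y := by
  intro A u hu
  rw [quadSite_affineField_eq_probeSym hV, ← inner_probeSym_self A u]
  exact h (probeSym A) (probeSym_isSymmetric A) u hu

/-- Conjugating a symmetric probe by a linear isometry (`Fcc.conjA L A = L⁻¹ A L`) gives a symmetric probe. -/
theorem conjA_isSymmetric (L : E3 ≃ₗᵢ[ℝ] E3) {A : E3 →ₗ[ℝ] E3} (hA : A.IsSymmetric) : (Fcc.conjA L A).IsSymmetric := by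
  intro v w
  rw [Fcc.conjA_apply, Fcc.conjA_apply, ← L.inner_map_map (L.symm (A (L v))) w, L.apply_symm_apply, hA (L v) (L w),
    ← L.inner_map_map v (L.symm (A (L w))), L.apply_symm_apply]

/-- ★ TRANSPORT OF SYMMETRIC-PROBE SITEWISE AFFINE STABILITY along a rigid motion `x ↦ L x + c` (as `Fcc.sitewiseAffineStability_transport`, with the
probe class restricted to symmetric maps — closed under conjugation by isometries). -/
theorem sitewiseAffineStabilitySym_transport (L : E3 ≃ₗᵢ[ℝ] E3) (c : E3) {P P' : PeriodicConfiguration 3} {X X' : Set E3}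
    (hP : P'.points = (fun x => L x + c) '' P.points) (hX : X' = (fun x => L x + c) '' X) (y : E3) (κ : ℝ)
    (h : ∀ A : E3 →ₗ[ℝ] E3, A.IsSymmetric → ∀ u : E3, ‖u‖ = 1 → κ * inner ℝ u (A u) ^ 2 ≤ quadSite (affineField A) P X y) :
    ∀ A : E3 →ₗ[ℝ] E3, A.IsSymmetric → ∀ u : E3, ‖u‖ = 1 → κ * inner ℝ u (A u) ^ 2 ≤ quadSite (affineField A) P' X' (L y + c) := by
  intro A hA u hu
  rw [Fcc.quadSite_affineField_transport L c A hP hX y]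
  have hu' : ‖L.symm u‖ = 1 := by rw [L.symm.norm_map]; exact hu
  have key := h (Fcc.conjA L A) (conjA_isSymmetric L hA) (L.symm u) hu'
  have hin : inner ℝ (L.symm u) (Fcc.conjA L A (L.symm u)) = inner ℝ u (A u) := by
    rw [Fcc.conjA_apply, L.apply_symm_apply, L.symm.inner_map_map]
  rwa [hin] at key

end VirialForms

/-! ## §N8 (R-ii): the hcp affine stability certificate over symmetric probes and the repaired class-level [A-i]ʰ glue -/

namespace Hcp

/-- ★ piece STAB-h-boxˢʸᵐ (R-ii) · UNDECIDED · TRUE-leaning · CERT-able · **THE hcp AFFINE STABILITY CERTIFICATE OVER SYMMETRIC PROBES** (parameters: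
the (U-h) box `[a₁, a₂] × [h₁, h₂]` and the constant `κ`): for `ε ∈ {1, −1}`, `(a, h)` in the box, the two base sites `m ∈ {0, 1}`, every SYMMETRIC
probe `A` (`∀ v w, ⟪A v, w⟫ = ⟪v, A w⟫`) and every unit `u`: `κ·⟪u, A u⟫² ≤ ¼·Σ'_t quadTermAff a h (ε·alternatingHagg) m 0 0 A t`.  No stress-free
hypothesis inside (an interval engine runs it as typed); census floats: `κ_sym ≈ 3.72` at the hcp root, `3.63–3.80` at the designate corners, vs `κ = 3/8`.
Why it might fail: a soft SYMMETRIC (shear/uniaxial) direction of the strained hcp family inside the box — none numerically (margin `× 9.7`); the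
antisymmetric directions that falsified `HcpAffineStabilityBox` are excluded here and handled exactly by (R-i) on the consumer side. -/
def HcpAffineStabilityBoxSym (a₁ a₂ h₁ h₂ κ : ℝ) : Prop :=
  ∀ (ε : ℤ) (a h : ℝ), (ε = 1 ∨ ε = -1) → a₁ ≤ a → a ≤ a₂ → h₁ ≤ h → h ≤ h₂ → ∀ m : ℤ, (m = 0 ∨ m = 1) →
    ∀ A : E3 →ₗ[ℝ] E3, A.IsSymmetric → ∀ u : E3, ‖u‖ = 1 →
      κ * inner ℝ u (A u) ^ 2 ≤ (1 / 4) * ∑' t : ℤ × ℤ × ℤ, quadTermAff a h (fun i => ε * alternatingHagg i) m 0 0 A t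

/-- The (vacuous-as-typed) all-probe certificate implies the symmetric-probe one — nothing proved from `HcpAffineStabilityBox` is lost. -/
theorem hcpAffineStabilityBoxSym_of_box {a₁ a₂ h₁ h₂ κ : ℝ} (h : HcpAffineStabilityBox a₁ a₂ h₁ h₂ κ) :
    HcpAffineStabilityBoxSym a₁ a₂ h₁ h₂ κ :=
  fun ε a hh hε h₁' h₂' h₃' h₄' m hm A _ u hu => h ε a hh hε h₁' h₂' h₃' h₄' m hm A u hu

/-- The symmetric-probe certificate is antitone in `κ`. -/
theorem HcpAffineStabilityBoxSym.mono {a₁ a₂ h₁ h₂ κ κ' : ℝ} (hκ : κ' ≤ κ) (h : HcpAffineStabilityBoxSym a₁ a₂ h₁ h₂ κ) :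
    HcpAffineStabilityBoxSym a₁ a₂ h₁ h₂ κ' :=
  fun ε a hh hε h₁' h₂' h₃' h₄' m hm A hA u hu =>
    le_trans (mul_le_mul_of_nonneg_right hκ (sq_nonneg _)) (h ε a hh hε h₁' h₂' h₃' h₄' m hm A hA u hu)

/-- ★★ **CLASS-LEVEL [A-i]ʰ FROM THE TWO hcp CERTIFICATES, REPAIRED**: given `HcpScaleBox a₁ a₂ h₁ h₂` ((U-h)-box) and `HcpAffineStabilityBoxSym a₁ a₂ h₁ h₂ κ`
(STAB-h over symmetric probes on that box), EVERY site-stress-free periodic presentation of an isometric image of an hcp-class Barlow stacking (Hägg word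
with alternating letters, window) satisfies the sitewise affine stability inequality with constant `κ` at EVERY point and for EVERY probe.  Proof:
`(a, h)` is in the box (`hcpClass_scale_mem_box`); rigid presentation `x ↦ L x + c` of `P₀ := barlowPeriodicConfiguration (ε·alternatingHagg)`; the
symmetric-probe inequality at the base site from the certificate (`quadSite_affineField_barlow_eq_tsum`), transported along the period
(`points_eq_image_add_of_mem_lattice`) and the rigid motion (`sitewiseAffineStabilitySym_transport`, twice); all probes at the image point by (R-i)
(`sitewiseAffineStability_of_symm`, site virial zero by `IsSiteStressFree.siteVirial_eq_zero`). -/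
theorem sitewiseAffineStability_hcpClass_of_boxSym {a₁ a₂ h₁ h₂ κ : ℝ} (hN : HcpScaleBox a₁ a₂ h₁ h₂)
    (hQ : HcpAffineStabilityBoxSym a₁ a₂ h₁ h₂ κ) (P : PeriodicConfiguration 3) {a h : ℝ} {s : ℤ → ℤ} {g : E3 → E3}
    (ha : 9 / 10 ≤ a ∧ a ≤ 11 / 10) (hh : 0 < h ∧ 27 / 50 * a ^ 2 ≤ h ^ 2 ∧ h ^ 2 ≤ 121 / 150 * a ^ 2) (hH : IsHaggSeq s) (hs : ∀ i, s (i + 1) = -s i)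
    (hg : Isometry g) (hP : P.points = g '' barlowStacking a h s) (hS : IsSiteStressFree P) :
    ∀ y ∈ P.points, ∀ (A : E3 →ₗ[ℝ] E3) (u : E3), ‖u‖ = 1 → κ * inner ℝ u (A u) ^ 2 ≤ quadSite (affineField A) P ∅ y := by
  obtain ⟨hb₁, hb₂, hb₃, hb₄⟩ := hcpClass_scale_mem_box hN P ha hh hH hs hg hP hS
  obtain ⟨L, c, hLc⟩ := Fcc.exists_linearIsometryEquiv_of_isometry hg
  have ha0 : 0 < a := by linarith [ha.1]
  have hg' : g = fun x => L x + c := funext hLc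
  have hw : s = fun i => s 0 * alternatingHagg i := word_eq_smul_alternating hs
  set s' : ℤ → ℤ := fun i => s 0 * alternatingHagg i with hs'
  let P₀ : PeriodicConfiguration 3 := barlowPeriodicConfiguration s' ha0.ne' hh.1.ne' two_ne_zero (smul_alternatingHagg_periodic (s 0))
  have hP₀ : P₀.points = barlowStacking a h s' := barlowPeriodicConfiguration_points s' ha0.ne' hh.1.ne' two_ne_zero _
  have hPP₀ : P.points = (fun x => L x + c) '' P₀.points := by rw [hP₀, hP, hg', ← hw]
  have hX : (∅ : Set E3) = (fun x => L x + c) '' ∅ := by simp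
  intro y hy
  refine sitewiseAffineStability_of_symm (hS.siteVirial_eq_zero hy) ?_
  rw [hPP₀] at hy
  obtain ⟨w, hw₀, rfl⟩ := hy
  obtain ⟨q, hq, g₀, hg₀, rfl⟩ := hw₀
  obtain ⟨n, hn, rfl⟩ := Finset.mem_image.1 hq
  have hn2 : (n : ℤ) = 0 ∨ (n : ℤ) = 1 := by
    have := Finset.mem_range.1 hn
    omega
  -- symmetric-probe stability at the base site `barlowPos n 0 0` of `P₀`, from the certificate
  have h0 : ∀ A : E3 →ₗ[ℝ] E3, A.IsSymmetric → ∀ u : E3, ‖u‖ = 1 →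
      κ * inner ℝ u (A u) ^ 2 ≤ quadSite (affineField A) P₀ ∅ (barlowPos a h s' (n : ℤ) 0 0) := by
    intro A' hA' u' hu'
    rw [quadSite_affineField_barlow_eq_tsum ha0 hh.1 hP₀ (n : ℤ) 0 0 A']
    exact hQ (s 0) a h (hH 0) hb₁ hb₂ hb₃ hb₄ (n : ℤ) hn2 A' hA' u' hu'
  -- along the period `g₀`
  have h1 := sitewiseAffineStabilitySym_transport (LinearIsometryEquiv.refl ℝ E3) g₀ (P := P₀) (P' := P₀) (X := ∅) (X' := ∅)
    (points_eq_image_add_of_mem_lattice P₀ hg₀) (by simp) (barlowPos a h s' (n : ℤ) 0 0) κ h0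
  simp only [LinearIsometryEquiv.coe_refl, id_eq] at h1
  -- along the rigid motion
  exact sitewiseAffineStabilitySym_transport L c (P := P₀) (P' := P) hPP₀ hX (barlowPos a h s' (n : ℤ) 0 0 + g₀) κ h1

end Hcp

end Summit.AtomisticToContinuum.Crystallization.Theorems.ChargedEnergyGapChartDial

end
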